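import Literature.MathematicalPhysics.QuantumLattice.LatticeGaugeDLRBoxKernels
import Literature.Probability.LatticeModels.CoarseCellMixingDLR
import Summits.QuantumFields.YangMills.Theorems.OneCertifiedCubeFiniteSizeCriterionChainRule
import HarnessLib

/-!
# The Dobrushin–Shlosman block recursion for a range-one specification on the edges of `ℤᵈ`

Helper file for item `stmt-QuantumFields-8895` (`FiniteSizeCriterion` of route `OneCertifiedCube`,
sub-problem `YangMills`).

Setting: a specification `γ` (Georgii) on `ZdEdge d → S` which is **range one** in the sense of the
Wilson interaction — the kernel average of a cylinder observable with support `T` is a cylinder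
observable supported on `T` and the edges of the plaquettes touching the volume (`hloc`, which for
the lattice Yang–Mills specification is `dependsOn_integral_ymSpecification`) — read through a cell
map `cell : ZdEdge d → ℤᵈ` contracting unit steps (`hC1`, e.g. `e ↦ (⌊e.1 i / b⌋)ᵢ`) with finite
cells.

* `recursion_step` — ONE STEP of the block recursion: if the total-variation finite-size condition at
  window `n` and threshold `ε` holds (central-cell influence `≤ ε` of exterior changes outside the
  cube of `(4n+1)ᵈ` cells, for every cell-union volume inside the cube containing the central cell)
  and the single-cell boundary influence at agreement radius `j(2n+1)` is `≤ δ` for every cell-union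
  volume, then at radius `(j+1)(2n+1)` it is `≤ ε · M · δ`, `M = (4n+3)ᵈ - (4n+1)ᵈ` the number of
  shell cells: localise to the cube by consistency, observe that the localised observable oscillates
  by `≤ ε` (finite-size condition) and depends only on the `≤ M` shell cells, rescale it to `[0,1]`
  and apply the chain rule `multiCell_influence_general`.
* `recursion_decay` — iterating from the trivial bound `1`: influence `≤ (ε M)^j` at radius `j(2n+1)`.

## References

* R. L. Dobrushin, S. B. Shlosman, *Constructive criterion for the uniqueness of Gibbs field*
  (1985), §2 (conditions `C_V` and the block recursion).
* F. Martinelli, *Lectures on Glauber dynamics for discrete spin models* (1999), §2.3.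
* J. van den Berg, C. Maes, Ann. Probab. 22 (1994).
-/

noncomputable section

open MeasureTheory
open Literature.Probability.LatticeModels
open Literature.MathematicalPhysics.QuantumLattice

namespace Summit.QuantumFields.YangMills.Theorems.FiniteSizeCriterion

variable {d : ℕ} {S : Type*} [MeasurableSpace S]

/-- The number of lattice points of `ℤᵈ` in the cube `∏ᵢ [xᵢ - r, xᵢ + r]` is `(2r+1)ᵈ`. -/
theorem card_piFinset_Icc (x : Fin d → ℤ) (r : ℕ) :
    (Fintype.piFinset fun i => Finset.Icc (x i - r) (x i + r)).card = (2 * r + 1) ^ d := by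
  rw [Fintype.card_piFinset]
  have h : ∀ i, (Finset.Icc (x i - r) (x i + r)).card = 2 * r + 1 := fun i => by
    rw [Int.card_Icc]
    omega
  simp only [h, Finset.prod_const, Finset.card_univ, Fintype.card_fin]

/-- A finite set of cells in the shell `{y | |y - x|_∞ ≤ r + 1} ∖ {y | |y - x|_∞ ≤ r}` has at most
`(2r+3)ᵈ - (2r+1)ᵈ` elements. -/
theorem card_shell_le (x : Fin d → ℤ) (r : ℕ) (Y : Finset (Fin d → ℤ))
    (hY : ∀ y ∈ Y, (∀ i, |y i - x i| ≤ r + 1) ∧ ¬ (∀ i, |y i - x i| ≤ r)) :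
    Y.card ≤ (2 * (r + 1) + 1) ^ d - (2 * r + 1) ^ d := by
  classical
  set big := Fintype.piFinset fun i => Finset.Icc (x i - (r + 1 : ℕ)) (x i + (r + 1 : ℕ)) with hbig
  set small := Fintype.piFinset fun i => Finset.Icc (x i - r) (x i + r) with hsmall
  have hsub : small ⊆ big := by
    intro y hy
    rw [hsmall, Fintype.mem_piFinset] at hy
    rw [hbig, Fintype.mem_piFinset]
    intro i
    have := Finset.mem_Icc.1 (hy i)
    refine Finset.mem_Icc.2 ⟨?_, ?_⟩ <;> push_cast <;> omega
  have hYsub : Y ⊆ big \ small := by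
    intro y hy
    obtain ⟨h1, h2⟩ := hY y hy
    rw [Finset.mem_sdiff]
    constructor
    · rw [hbig, Fintype.mem_piFinset]
      intro i
      have := abs_le.1 (h1 i)
      refine Finset.mem_Icc.2 ⟨?_, ?_⟩ <;> push_cast <;> omega
    · intro hmem
      rw [hsmall, Fintype.mem_piFinset] at hmem
      exact h2 fun i => by
        have := Finset.mem_Icc.1 (hmem i)
        rw [abs_le]
        constructor <;> omega
  calc Y.card ≤ (big \ small).card := Finset.card_le_card hYsub
    _ = big.card - small.card := Finset.card_sdiff_of_subset hsub
    _ = (2 * (r + 1) + 1) ^ d - (2 * r + 1) ^ d := by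
        rw [hbig, hsmall, card_piFinset_Icc, card_piFinset_Icc]

/-- The expectation of an observable against a proper kernel `γ_Λ(· | η)` equals its value at `η`
when the observable depends only on sites off `Λ`. -/
theorem kernel_integral_eq_of_dependsOn_compl {V : Type*} {γ : Specification V S}
    (hγ : IsSpecification γ) (Λ : Finset V) {g : (V → S) → ℝ} (hg : DependsOn g ((↑Λ : Set V)ᶜ))
    (η : V → S) : ∫ σ, g σ ∂(γ Λ η) = g η := by
  haveI := hγ.isProbability Λ η
  have h : ∫ σ, g σ ∂(γ Λ η) = ∫ _σ, g η ∂(γ Λ η) := by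
    refine integral_congr_ae ?_
    filter_upwards [hγ.proper Λ η] with σ hσ
    exact hg fun v hv => hσ v fun h => hv (Finset.mem_coe.2 h)
  rw [h, integral_const]
  simp

/-- **One step of the Dobrushin–Shlosman block recursion** (total-variation finite-size condition,
universal threshold). See the module docstring. The agreement radii are measured in cells of the
cell map `cell`, in the `ℓ^∞` distance. -/
theorem recursion_step {γ : Specification (ZdEdge d) S} (hγ : IsSpecification γ)
    (hloc : ∀ (Λ : Finset (ZdEdge d)) (f : (ZdEdge d → S) → ℝ) (T : Finset (ZdEdge d)),
      Measurable f → DependsOn f ↑T →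
        DependsOn (fun η => ∫ σ, f σ ∂(γ Λ η)) ↑(T ∪ (plaquettesTouching Λ).biUnion plaquetteEdges))
    {cell : ZdEdge d → (Fin d → ℤ)}
    (hC1 : ∀ e e' : ZdEdge d, (∀ k, e'.1 k - 1 ≤ e.1 k ∧ e.1 k ≤ e'.1 k + 1) →
      ∀ k, |cell e k - cell e' k| ≤ 1)
    (hfin : ∀ y : Fin d → ℤ, Set.Finite {v : ZdEdge d | cell v = y})
    {n : ℕ} {ε : ℝ} (hε : 0 ≤ ε)
    (hFS : ∀ (x : Fin d → ℤ) (Λ₀ : Finset (ZdEdge d)),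
      (∀ v w, cell v = cell w → v ∈ Λ₀ → w ∈ Λ₀) →
      (∀ v ∈ Λ₀, ∀ i, |cell v i - x i| ≤ 2 * n) → (∀ v, cell v = x → v ∈ Λ₀) →
      ∀ η η' : ZdEdge d → S, (∀ v, (∀ i, |cell v i - x i| ≤ 2 * n) → η v = η' v) →
      ∀ f : (ZdEdge d → S) → ℝ, DependsOn f {v | cell v = x} → Measurable f →
        (∀ σ, 0 ≤ f σ ∧ f σ ≤ 1) → |∫ σ, f σ ∂(γ Λ₀ η) - ∫ σ, f σ ∂(γ Λ₀ η')| ≤ ε)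
    {j : ℕ} {δ : ℝ}
    (hT : ∀ (Λ : Finset (ZdEdge d)), (∀ v w, cell v = cell w → v ∈ Λ → w ∈ Λ) →
      ∀ (x : Fin d → ℤ) (g : (ZdEdge d → S) → ℝ), Measurable g → (∀ σ, 0 ≤ g σ ∧ g σ ≤ 1) →
      DependsOn g {v | cell v = x} →
      ∀ ζ ζ' : ZdEdge d → S,
        (∀ v, v ∉ Λ → (∀ i, |cell v i - x i| ≤ j * (2 * n + 1)) → ζ v = ζ' v) →
        |∫ σ, g σ ∂(γ Λ ζ) - ∫ σ, g σ ∂(γ Λ ζ')| ≤ δ)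
    (Λ : Finset (ZdEdge d)) (hΛ : ∀ v w, cell v = cell w → v ∈ Λ → w ∈ Λ)
    (x : Fin d → ℤ) (g : (ZdEdge d → S) → ℝ) (hgm : Measurable g) (hg01 : ∀ σ, 0 ≤ g σ ∧ g σ ≤ 1)
    (hgdep : DependsOn g {v | cell v = x}) (ζ ζ' : ZdEdge d → S)
    (hagree : ∀ v, v ∉ Λ → (∀ i, |cell v i - x i| ≤ (j + 1) * (2 * n + 1)) → ζ v = ζ' v) :
    |∫ σ, g σ ∂(γ Λ ζ) - ∫ σ, g σ ∂(γ Λ ζ')| ≤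
      ε * (((2 * (2 * n + 1) + 1) ^ d - (2 * (2 * n) + 1) ^ d : ℕ) : ℝ) * δ := by
  classical
  -- `δ ≥ 0`: the single-cell hypothesis at a constant observable
  have hδ : 0 ≤ δ := (abs_nonneg _).trans (hT ∅ (fun v _ _ h => absurd h (Finset.notMem_empty v))
    x (fun _ => 0) measurable_const (fun _ => ⟨le_rfl, zero_le_one⟩) (fun _ _ _ => rfl) ζ ζ
    (fun _ _ _ => rfl))
  have hMδ : 0 ≤ ε * (((2 * (2 * n + 1) + 1) ^ d - (2 * (2 * n) + 1) ^ d : ℕ) : ℝ) * δ := by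
    positivity
  set R : ℤ := 2 * n with hR
  have hR0 : (0 : ℤ) ≤ R := by rw [hR]; positivity
  have hR1 : R + 1 ≤ (j + 1 : ℤ) * (2 * n + 1) := by rw [hR]; nlinarith
  -- trivial case: the cell `x` does not meet `Λ`
  by_cases hx : ∃ v ∈ Λ, cell v = x
  swap
  · have hgc : DependsOn g ((↑Λ : Set (ZdEdge d))ᶜ) := fun σ σ' h =>
      hgdep fun v (hv : cell v = x) => h v fun hvΛ => hx ⟨v, Finset.mem_coe.1 hvΛ, hv⟩
    rw [kernel_integral_eq_of_dependsOn_compl hγ Λ hgc ζ,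
      kernel_integral_eq_of_dependsOn_compl hγ Λ hgc ζ']
    have hζ : g ζ = g ζ' := hgdep fun v (hv : cell v = x) =>
      hagree v (fun hvΛ => hx ⟨v, hvΛ, hv⟩) fun i => by
        rw [hv, sub_self, abs_zero]; positivity
    rw [hζ, sub_self, abs_zero]
    exact hMδ
  -- the localised volume `Λ₀ = Λ ∩ cube`
  obtain ⟨v₀, hv₀Λ, hv₀x⟩ := hx
  set Λ₀ : Finset (ZdEdge d) := Λ.filter fun v => ∀ i, |cell v i - x i| ≤ R with hΛ₀
  have hΛ₀Λ : Λ₀ ⊆ Λ := Finset.filter_subset _ _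
  have hΛ₀union : ∀ v w, cell v = cell w → v ∈ Λ₀ → w ∈ Λ₀ := fun v w hvw hv => by
    rw [hΛ₀, Finset.mem_filter] at hv ⊢
    exact ⟨hΛ v w hvw hv.1, fun i => hvw ▸ hv.2 i⟩
  have hΛ₀near : ∀ v ∈ Λ₀, ∀ i, |cell v i - x i| ≤ 2 * n := fun v hv =>
    (Finset.mem_filter.1 hv).2
  have hxΛ₀ : ∀ v, cell v = x → v ∈ Λ₀ := fun v hv =>
    Finset.mem_filter.2 ⟨hΛ v₀ v (hv₀x.trans hv.symm) hv₀Λ, fun i => by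
      rw [hv, sub_self, abs_zero]; exact hR0⟩
  have hnotΛ : ∀ v, v ∉ Λ₀ → (∀ i, |cell v i - x i| ≤ R) → v ∉ Λ := fun v hv hd hvΛ =>
    hv (Finset.mem_filter.2 ⟨hvΛ, hd⟩)
  -- the localised observable `g₀ = γ_{Λ₀} g`
  set g₀ : (ZdEdge d → S) → ℝ := fun σ => ∫ τ, g τ ∂(γ Λ₀ σ) with hg₀
  have hg₀m : Measurable g₀ := DobrushinShlosman.measurable_windowAvg' hγ Λ₀ hgm
  have hg₀01 : ∀ σ, 0 ≤ g₀ σ ∧ g₀ σ ≤ 1 := fun σ => by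
    haveI := hγ.isProbability Λ₀ σ
    exact integral_mem_unitInterval hgm hg01
  have hg1 : ∀ σ, |g σ| ≤ 1 := fun σ => by rw [abs_of_nonneg (hg01 σ).1]; exact (hg01 σ).2
  have hcons : ∀ η, ∫ σ, g σ ∂(γ Λ η) = ∫ σ, g₀ σ ∂(γ Λ η) := fun η =>
    (kernel_integral_integral_eq_of_subset hγ hΛ₀Λ η hgm hg1).symm
  -- `g₀` depends only on the edges off `Λ₀` within cell distance `R + 1`
  have hgT : DependsOn g (↑(hfin x).toFinset : Set (ZdEdge d)) := fun σ σ' h =>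
    hgdep fun v hv => h v (by rw [Set.Finite.coe_toFinset]; exact hv)
  have hg₀dep' := hloc Λ₀ g (hfin x).toFinset hgm hgT
  have hg₀dep : DependsOn g₀ {v | v ∉ Λ₀ ∧ ∀ i, |cell v i - x i| ≤ R + 1} := by
    intro σ σ' h
    let σ'' : ZdEdge d → S := fun v => if v ∈ Λ₀ then σ v else σ' v
    have e1 : g₀ σ' = g₀ σ'' := by
      simp only [hg₀]
      rw [DobrushinShlosman.spec_apply_congr hγ Λ₀ (ω := σ') (η := σ'') fun v hv => by
        simp only [σ'', hv, if_false]]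
    have e2 : g₀ σ'' = g₀ σ := by
      refine hg₀dep' fun v hv => ?_
      by_cases hvΛ₀ : v ∈ Λ₀
      · simp only [σ'', hvΛ₀, if_true]
      · simp only [σ'', hvΛ₀, if_false]
        refine (h v ⟨hvΛ₀, ?_⟩).symm
        rcases Finset.mem_union.1 (Finset.mem_coe.1 hv) with hvT | hvC
        · have hvx : cell v = x := (hfin x).mem_toFinset.1 hvT
          intro i; rw [hvx, sub_self, abs_zero]; positivity
        · obtain ⟨e', he', hnear⟩ := exists_near_of_mem_collar hvC
          intro i
          have h1 := hC1 v e' hnear i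
          have h2 := hΛ₀near e' he' i
          calc |cell v i - x i| = |(cell v i - cell e' i) + (cell e' i - x i)| := by ring_nf
            _ ≤ |cell v i - cell e' i| + |cell e' i - x i| := abs_add_le _ _
            _ ≤ 1 + R := add_le_add h1 h2
            _ = R + 1 := add_comm _ _
    rw [← e2, ← e1]
  -- oscillation `≤ ε` of `g₀` on configurations equal to `ζ` on the cube edges off `Λ`
  have hosc : ∀ σ σ' : ZdEdge d → S,
      (∀ v, v ∉ Λ → (∀ i, |cell v i - x i| ≤ R) → σ v = ζ v) →
      (∀ v, v ∉ Λ → (∀ i, |cell v i - x i| ≤ R) → σ' v = ζ v) → |g₀ σ - g₀ σ'| ≤ ε := by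
    intro σ σ' hσ hσ'
    let τ : (ZdEdge d → S) → (ZdEdge d → S) := fun ω v => if v ∈ Λ₀ then ζ v else ω v
    have hτ : ∀ ω, g₀ ω = g₀ (τ ω) := fun ω => by
      simp only [hg₀]
      rw [DobrushinShlosman.spec_apply_congr hγ Λ₀ (ω := ω) (η := τ ω) fun v hv => by
        simp only [τ, hv, if_false]]
    rw [hτ σ, hτ σ']
    refine hFS x Λ₀ hΛ₀union hΛ₀near hxΛ₀ (τ σ) (τ σ') (fun v hd => ?_) g hgdep hgm hg01
    by_cases hv : v ∈ Λ₀
    · simp only [τ, hv, if_true]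
    · simp only [τ, hv, if_false]
      rw [hσ v (hnotΛ v hv hd) hd, hσ' v (hnotΛ v hv hd) hd]
  -- the infimum `a` of `g₀` over these configurations
  set Rset : Set (ZdEdge d → S) := {σ | ∀ v, v ∉ Λ → (∀ i, |cell v i - x i| ≤ R) → σ v = ζ v}
    with hRset
  have hζR : ζ ∈ Rset := fun _ _ _ => rfl
  have hbdd : BddBelow (g₀ '' Rset) := ⟨0, fun r ⟨σ, _, hr⟩ => hr ▸ (hg₀01 σ).1⟩
  set a : ℝ := sInf (g₀ '' Rset) with ha
  have ha_le : ∀ σ ∈ Rset, a ≤ g₀ σ := fun σ hσ => csInf_le hbdd ⟨σ, hσ, rfl⟩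
  have hle_a : ∀ σ ∈ Rset, g₀ σ ≤ a + ε := fun σ hσ => by
    have h : g₀ σ - ε ≤ a := le_csInf ⟨g₀ ζ, ζ, hζR, rfl⟩ fun r ⟨σ', hσ', hr⟩ => by
      rw [← hr]
      have := abs_le.1 (hosc σ σ' hσ hσ')
      linarith
    linarith
  -- the shell cells of `Λ` and the frozen, rescaled observable `H`
  set Ysh : Finset (Fin d → ℤ) := (Λ.image cell).filter fun y =>
    (∀ i, |y i - x i| ≤ R + 1) ∧ ¬ (∀ i, |y i - x i| ≤ R) with hYsh
  let Φ : (ZdEdge d → S) → (ZdEdge d → S) := fun σ v => if cell v ∈ Ysh then σ v else ζ v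
  have hΦm : Measurable Φ := by
    refine measurable_pi_iff.2 fun v => ?_
    by_cases hv : cell v ∈ Ysh
    · simp only [Φ, hv, if_true]; exact measurable_pi_apply v
    · simp only [Φ, hv, if_false]; exact measurable_const
  set H : (ZdEdge d → S) → ℝ := fun σ => min 1 (max 0 ((g₀ (Φ σ) - a) / ε)) with hH
  have hHm : Measurable H :=
    measurable_const.min (measurable_const.max (((hg₀m.comp hΦm).sub_const a).div_const ε))
  have hH01 : ∀ σ, 0 ≤ H σ ∧ H σ ≤ 1 := fun σ =>
    ⟨le_min zero_le_one (le_max_left _ _), min_le_left _ _⟩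
  have hHdep : DependsOn H {v | cell v ∈ Ysh} := by
    intro σ σ' h
    simp only [hH]
    have hΦ : Φ σ = Φ σ' := funext fun v => by
      by_cases hv : cell v ∈ Ysh
      · simp only [Φ, hv, if_true]; exact h v hv
      · simp only [Φ, hv, if_false]
    rw [hΦ]
  -- under `γ_Λ(· | η)`, `η = ζ` on the shell-and-cube edges off `Λ`, `g₀ = a + ε H` a.s.
  have hkey : ∀ η : ZdEdge d → S, (∀ v, v ∉ Λ → (∀ i, |cell v i - x i| ≤ R + 1) → η v = ζ v) →
      ∀ᵐ σ ∂(γ Λ η), g₀ σ = a + ε * H σ := by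
    intro η hη
    filter_upwards [hγ.proper Λ η] with σ hσ
    have hσR : σ ∈ Rset := fun v hv hd => by
      rw [hσ v hv]; exact hη v hv fun i => (hd i).trans (by linarith)
    have hΦσ : g₀ (Φ σ) = g₀ σ := by
      refine hg₀dep fun v hv => ?_
      obtain ⟨hv₀, hvd⟩ := hv
      by_cases hc : cell v ∈ Ysh
      · simp only [Φ, hc, if_true]
      · simp only [Φ, hc, if_false]
        by_cases hvΛ : v ∈ Λ
        · exfalso
          refine hc (Finset.mem_filter.2 ⟨Finset.mem_image_of_mem _ hvΛ, hvd, fun hd => ?_⟩)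
          exact hv₀ (Finset.mem_filter.2 ⟨hvΛ, hd⟩)
        · rw [hσ v hvΛ, hη v hvΛ hvd]
    have h1 := ha_le σ hσR
    have h2 := hle_a σ hσR
    simp only [hH, hΦσ]
    rcases hε.eq_or_lt with hε0 | hεpos
    · rw [← hε0, zero_mul, add_zero]
      rw [← hε0, add_zero] at h2
      exact le_antisymm h2 h1
    · have ht0 : 0 ≤ (g₀ σ - a) / ε := div_nonneg (by linarith) hεpos.le
      have ht1 : (g₀ σ - a) / ε ≤ 1 := by rw [div_le_one hεpos]; linarith
      rw [max_eq_right ht0, min_eq_right ht1]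
      field_simp
      ring
  have hint : ∀ η : ZdEdge d → S, (∀ v, v ∉ Λ → (∀ i, |cell v i - x i| ≤ R + 1) → η v = ζ v) →
      ∫ σ, g₀ σ ∂(γ Λ η) = a + ε * ∫ σ, H σ ∂(γ Λ η) := by
    intro η hη
    haveI := hγ.isProbability Λ η
    have hHi : Integrable H (γ Λ η) := DobrushinMetric.integrable_of_abs_le' hHm (M := 1)
      fun σ => by rw [abs_of_nonneg (hH01 σ).1]; exact (hH01 σ).2
    rw [integral_congr_ae (hkey η hη), integral_add (integrable_const a) (hHi.const_mul ε),
      integral_const, integral_const_mul]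
    simp
  -- the chain rule over the shell cells
  have hchain : |∫ σ, H σ ∂(γ Λ ζ) - ∫ σ, H σ ∂(γ Λ ζ')| ≤ Ysh.card * δ := by
    refine multiCell_influence_general (cell := cell)
      (near := fun y v => ∀ i, |cell v i - y i| ≤ j * (2 * n + 1))
      (fun v i => by rw [sub_self, abs_zero]; positivity) hγ hT Ysh Λ hΛ H hHm hH01 hHdep ζ ζ'
      fun y hy v hv hd => hagree v hv fun i => ?_
    have hy1 : |y i - x i| ≤ R + 1 := ((Finset.mem_filter.1 hy).2.1) i
    calc |cell v i - x i| = |(cell v i - y i) + (y i - x i)| := by ring_nf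
      _ ≤ |cell v i - y i| + |y i - x i| := abs_add_le _ _
      _ ≤ j * (2 * n + 1) + (R + 1) := add_le_add (hd i) hy1
      _ = (j + 1) * (2 * n + 1) := by rw [hR]; ring
  -- at most `M` shell cells
  have hcard : Ysh.card ≤ (2 * (2 * n + 1) + 1) ^ d - (2 * (2 * n) + 1) ^ d := by
    refine card_shell_le x (2 * n) Ysh fun y hy => ?_
    have h := (Finset.mem_filter.1 hy).2
    simp only [hR] at h
    exact_mod_cast h
  -- assemble
  have hζ' : ∀ v, v ∉ Λ → (∀ i, |cell v i - x i| ≤ R + 1) → ζ' v = ζ v := fun v hv hd =>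
    (hagree v hv fun i => (hd i).trans hR1).symm
  rw [hcons ζ, hcons ζ', hint ζ (fun _ _ _ => rfl), hint ζ' hζ', add_sub_add_left_eq_sub,
    ← mul_sub, abs_mul, abs_of_nonneg hε, mul_assoc]
  refine mul_le_mul_of_nonneg_left (hchain.trans ?_) hε
  exact mul_le_mul_of_nonneg_right (by exact_mod_cast hcard) hδ

/-- **Exponential decay of the single-cell boundary influence from the finite-size condition**:
under the hypotheses of `recursion_step`, for every `j`, every cell-union volume `Λ`, every cell `x`
and every `[0,1]`-valued measurable observable `g` of the cell `x`, two boundary conditions that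
agree at the edges off `Λ` within cell distance `j(2n+1)` of `x` give `γ_Λ`-expectations of `g`
within `(ε M)^j`, `M = (4n+3)ᵈ - (4n+1)ᵈ` (induction on `j` from the trivial bound `1`). -/
theorem recursion_decay {γ : Specification (ZdEdge d) S} (hγ : IsSpecification γ)
    (hloc : ∀ (Λ : Finset (ZdEdge d)) (f : (ZdEdge d → S) → ℝ) (T : Finset (ZdEdge d)),
      Measurable f → DependsOn f ↑T →
        DependsOn (fun η => ∫ σ, f σ ∂(γ Λ η)) ↑(T ∪ (plaquettesTouching Λ).biUnion plaquetteEdges))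
    {cell : ZdEdge d → (Fin d → ℤ)}
    (hC1 : ∀ e e' : ZdEdge d, (∀ k, e'.1 k - 1 ≤ e.1 k ∧ e.1 k ≤ e'.1 k + 1) →
      ∀ k, |cell e k - cell e' k| ≤ 1)
    (hfin : ∀ y : Fin d → ℤ, Set.Finite {v : ZdEdge d | cell v = y})
    {n : ℕ} {ε : ℝ} (hε : 0 ≤ ε)
    (hFS : ∀ (x : Fin d → ℤ) (Λ₀ : Finset (ZdEdge d)),
      (∀ v w, cell v = cell w → v ∈ Λ₀ → w ∈ Λ₀) →
      (∀ v ∈ Λ₀, ∀ i, |cell v i - x i| ≤ 2 * n) → (∀ v, cell v = x → v ∈ Λ₀) →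
      ∀ η η' : ZdEdge d → S, (∀ v, (∀ i, |cell v i - x i| ≤ 2 * n) → η v = η' v) →
      ∀ f : (ZdEdge d → S) → ℝ, DependsOn f {v | cell v = x} → Measurable f →
        (∀ σ, 0 ≤ f σ ∧ f σ ≤ 1) → |∫ σ, f σ ∂(γ Λ₀ η) - ∫ σ, f σ ∂(γ Λ₀ η')| ≤ ε)
    (j : ℕ) (Λ : Finset (ZdEdge d)) (hΛ : ∀ v w, cell v = cell w → v ∈ Λ → w ∈ Λ)
    (x : Fin d → ℤ) (g : (ZdEdge d → S) → ℝ) (hgm : Measurable g) (hg01 : ∀ σ, 0 ≤ g σ ∧ g σ ≤ 1)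
    (hgdep : DependsOn g {v | cell v = x}) (ζ ζ' : ZdEdge d → S)
    (hagree : ∀ v, v ∉ Λ → (∀ i, |cell v i - x i| ≤ j * (2 * n + 1)) → ζ v = ζ' v) :
    |∫ σ, g σ ∂(γ Λ ζ) - ∫ σ, g σ ∂(γ Λ ζ')| ≤
      (ε * (((2 * (2 * n + 1) + 1) ^ d - (2 * (2 * n) + 1) ^ d : ℕ) : ℝ)) ^ j := by
  induction j generalizing Λ x g ζ ζ' with
  | zero =>
    haveI := hγ.isProbability Λ ζ
    haveI := hγ.isProbability Λ ζ'
    rw [pow_zero]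
    have h1 := integral_mem_unitInterval (μ := γ Λ ζ) hgm hg01
    have h2 := integral_mem_unitInterval (μ := γ Λ ζ') hgm hg01
    rw [abs_le]
    constructor <;> linarith [h1.1, h1.2, h2.1, h2.2]
  | succ j ih =>
    have h := recursion_step hγ hloc hC1 hfin hε hFS (j := j)
      (δ := (ε * (((2 * (2 * n + 1) + 1) ^ d - (2 * (2 * n) + 1) ^ d : ℕ) : ℝ)) ^ j)
      ih Λ hΛ x g hgm hg01 hgdep ζ ζ' (fun v hv hd => hagree v hv fun i => by
        have := hd i; push_cast; linarith)
    calc |∫ σ, g σ ∂(γ Λ ζ) - ∫ σ, g σ ∂(γ Λ ζ')|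
        ≤ ε * (((2 * (2 * n + 1) + 1) ^ d - (2 * (2 * n) + 1) ^ d : ℕ) : ℝ) *
          (ε * (((2 * (2 * n + 1) + 1) ^ d - (2 * (2 * n) + 1) ^ d : ℕ) : ℝ)) ^ j := h
      _ = (ε * (((2 * (2 * n + 1) + 1) ^ d - (2 * (2 * n) + 1) ^ d : ℕ) : ℝ)) ^ (j + 1) := by
          ring

end Summit.QuantumFields.YangMills.Theorems.FiniteSizeCriterion

end
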